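import Summits.AtomisticToContinuum.Crystallization.Theorems.GappedShellCensusTornFreeStubTfEmptySector
import Summits.AtomisticToContinuum.Crystallization.Theorems.GappedShellCensusTornFreeStubTfCircleThree
import Summits.AtomisticToContinuum.Crystallization.Theorems.GappedShellCensusTornFreeStubTfSectorWindows
import Literature.MathematicalPhysics.StatisticalMechanics.LocalMatchingCompactness

/-!
# Crux `GappedShellCensus.TornFree` (stmt-AtomisticToContinuum-18069), line `Sketch` —
# the kernel-checked LOCAL REDUCTION

The crux `TornFree` (every bond of an all-gapped-twelve configuration at scale `a`, tolerance
`1/50`, gap `63/50`, has `≥ 4` common neighbours) follows from ONE statement about FINITE point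
sets — the registered content stub `stub_tfNoWideGapLocal` of line `Sketch`, taken here as the
hypothesis `h` of `tornFree_of_noWideGapLocal`:

> a finite `Y ⊆ ℝ³` in which every pair is hard-core (`≥ 0.98a`) and bond-or-far (`≤ 1.02a` or
> `≥ 1.26a`), every site has at most twelve bonded neighbours and every site within `3a` of `y`
> exactly twelve, admits no bond `(y, v)` with `≤ 3` common neighbours all at azimuth `≥ 60°` from
> a unit direction `e ⊥ v − y` (given the sector windows).

Proof of the reduction (this file, sorry-free): a bond with `≤ 3` commons has an empty `120°`
azimuthal sector (`stub_tfCircleThree` p140320 + `stub_tfEmptySector` p140167); the sector windows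
are `stub_tfSectorWindows` (p147036); and the patch `Y ∩ B̄(y, 5a)` of an all-gapped-twelve `Y` is
finite (hard core + `finite_of_forall_le_dist_of_subset_closedBall`) and inherits every local
hypothesis (`tf_patch_hyps`).  So the crux is EQUIVALENT in difficulty to its finite certificate
form; the disprover's tables (Cruxes/TornFree/Disproof.lean: two-centre allgap `c = 3` feasible with
slack `+0.0032`, three-centre allgap misses the gap ratio `1.26` by `0.0019`) say that form needs at
least four twelve-coordinated sites jointly at tolerance `1/50`.
-/

noncomputable section

namespace Summit.AtomisticToContinuum.Crystallization.Theorems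

open Literature.Geometry.DiscreteGeometry
open Literature.MathematicalPhysics.StatisticalMechanics
open Summit.AtomisticToContinuum.Crystallization.Theses.GappedShellCensus
open scoped RealInnerProductSpace

/-- The common-neighbour set of a bond is finite (it sits inside the twelve-shell of `y`). -/
theorem tf_commons_finite {Y : Set (EuclideanSpace ℝ (Fin 3))} {a : ℝ} {y v : EuclideanSpace ℝ (Fin 3)}
    (hy12 : {w ∈ Y | w ≠ y ∧ dist y w ≤ a * (1 + 1 / 50)}.ncard = 12) :
    {w ∈ Y | w ≠ y ∧ w ≠ v ∧ dist y w ≤ a * (1 + 1 / 50) ∧ dist v w ≤ a * (1 + 1 / 50)}.Finite := by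
  have hfin : {w ∈ Y | w ≠ y ∧ dist y w ≤ a * (1 + 1 / 50)}.Finite :=
    Set.finite_of_ncard_ne_zero (by rw [hy12]; norm_num)
  exact hfin.subset fun w ⟨hw, hwy, _, hdy, _⟩ => ⟨hw, hwy, hdy⟩

/-- **Localisation.** In an all-gapped-twelve `Y`, the patch `Y' = {z ∈ Y | dist y z ≤ 5a}` about a
site `y ∈ Y` is finite, ALLGAP (every pair hard-core and bond-or-far), at most twelve-coordinated
everywhere and exactly twelve-coordinated within `3a` of `y`. -/
theorem tf_patch_hyps {Y : Set (EuclideanSpace ℝ (Fin 3))} {a : ℝ} (ha : 0 < a)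
    (hgood : ∀ y ∈ Y, ({w ∈ Y | w ≠ y ∧ dist y w ≤ a * (1 + 1 / 50)}.ncard = 12 ∧
      ∀ w ∈ Y, w ≠ y → a * (1 - 1 / 50) ≤ dist y w ∧
        (dist y w ≤ a * (1 + 1 / 50) ∨ a * (63 / 50) ≤ dist y w)))
    (y : EuclideanSpace ℝ (Fin 3)) :
    {z ∈ Y | dist y z ≤ a * 5}.Finite ∧
    (∀ p ∈ {z ∈ Y | dist y z ≤ a * 5}, ∀ q ∈ {z ∈ Y | dist y z ≤ a * 5}, p ≠ q →
      a * (1 - 1 / 50) ≤ dist p q ∧ (dist p q ≤ a * (1 + 1 / 50) ∨ a * (63 / 50) ≤ dist p q)) ∧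
    (∀ z ∈ {z ∈ Y | dist y z ≤ a * 5},
      {w ∈ {z ∈ Y | dist y z ≤ a * 5} | w ≠ z ∧ dist z w ≤ a * (1 + 1 / 50)}.ncard ≤ 12) ∧
    (∀ z ∈ {z ∈ Y | dist y z ≤ a * 5}, dist y z ≤ a * 3 →
      {w ∈ {z ∈ Y | dist y z ≤ a * 5} | w ≠ z ∧ dist z w ≤ a * (1 + 1 / 50)}.ncard = 12) := by
  set Y' : Set (EuclideanSpace ℝ (Fin 3)) := {z ∈ Y | dist y z ≤ a * 5} with hY'
  have hsub : Y' ⊆ Y := fun z hz => hz.1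
  have hsep : ∀ p ∈ Y, ∀ q ∈ Y, p ≠ q → a * (1 - 1 / 50) ≤ dist p q :=
    fun p hp q hq hpq => ((hgood p hp).2 q hq (Ne.symm hpq)).1
  refine ⟨?_, ?_, ?_, ?_⟩
  · -- finiteness: hard core + bounded
    refine finite_of_forall_le_dist_of_subset_closedBall (δ := a * (1 - 1 / 50)) (by positivity)
      (fun p hp q hq hpq => hsep p (hsub hp) q (hsub hq) hpq) (c := y) (R := a * 5) ?_
    intro z hz
    rw [Metric.mem_closedBall, dist_comm]
    exact hz.2
  · -- ALLGAP, inherited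
    intro p hp q hq hpq
    exact (hgood p (hsub hp)).2 q (hsub hq) (Ne.symm hpq)
  · -- at most twelve, inherited
    intro z hz
    have hfin : {w ∈ Y | w ≠ z ∧ dist z w ≤ a * (1 + 1 / 50)}.Finite :=
      Set.finite_of_ncard_ne_zero (by rw [(hgood z (hsub hz)).1]; norm_num)
    calc {w ∈ Y' | w ≠ z ∧ dist z w ≤ a * (1 + 1 / 50)}.ncard
        ≤ {w ∈ Y | w ≠ z ∧ dist z w ≤ a * (1 + 1 / 50)}.ncard :=
          Set.ncard_le_ncard (fun w ⟨hw, hwz, hd⟩ => ⟨hsub hw, hwz, hd⟩) hfin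
      _ = 12 := (hgood z (hsub hz)).1
  · -- exactly twelve within 3a: the whole shell of z lies in the patch
    intro z hz hz3
    have heq : {w ∈ Y' | w ≠ z ∧ dist z w ≤ a * (1 + 1 / 50)} =
        {w ∈ Y | w ≠ z ∧ dist z w ≤ a * (1 + 1 / 50)} := by
      ext w
      refine ⟨fun ⟨hw, hwz, hd⟩ => ⟨hsub hw, hwz, hd⟩, fun ⟨hw, hwz, hd⟩ => ⟨⟨hw, ?_⟩, hwz, hd⟩⟩
      calc dist y w ≤ dist y z + dist z w := dist_triangle _ _ _
        _ ≤ a * 3 + a * (1 + 1 / 50) := add_le_add hz3 hd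
        _ ≤ a * 5 := by nlinarith
    rw [heq]
    exact (hgood z (hsub hz)).1

/-- **Local reduction of the crux (kernel-checked).** `TornFree` follows from the finite ALLGAP
local statement (the registered content stub `stub_tfNoWideGapLocal` of line `Sketch`, hypothesis
`h`): localise to the patch `Y ∩ B̄(y, 5a)` (`tf_patch_hyps`), extract the empty `120°` sector of a
bond with `≤ 3` commons (`stub_tfEmptySector`, `stub_tfCircleThree`), feed the sector windows
(`stub_tfSectorWindows`). -/
theorem tornFree_of_noWideGapLocal :
    ((∀ (a : ℝ), 0 < a → ∀ y v w₁ w₂ : EuclideanSpace ℝ (Fin 3),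
        a * (1 - 1 / 50) ≤ dist y v → dist y v ≤ a * (1 + 1 / 50) →
        a * (1 - 1 / 50) ≤ dist y w₁ → dist y w₁ ≤ a * (1 + 1 / 50) →
        a * (1 - 1 / 50) ≤ dist v w₁ → dist v w₁ ≤ a * (1 + 1 / 50) →
        a * (1 - 1 / 50) ≤ dist y w₂ → dist y w₂ ≤ a * (1 + 1 / 50) →
        a * (1 - 1 / 50) ≤ dist v w₂ → dist v w₂ ≤ a * (1 + 1 / 50) →
        a * (1 - 1 / 50) ≤ dist w₁ w₂ →
        (dist w₁ w₂ ≤ a * (1 + 1 / 50) →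
            1 / 4 * (‖perpTo (v - y) (w₁ - y)‖ * ‖perpTo (v - y) (w₂ - y)‖) ≤
              ⟪perpTo (v - y) (w₁ - y), perpTo (v - y) (w₂ - y)⟫) ∧
        (a * (63 / 50) ≤ dist w₁ w₂ →
            ⟪perpTo (v - y) (w₁ - y), perpTo (v - y) (w₂ - y)⟫ ≤
              1 / 10 * (‖perpTo (v - y) (w₁ - y)‖ * ‖perpTo (v - y) (w₂ - y)‖))) →
      ∀ (Y : Set (EuclideanSpace ℝ (Fin 3))) (a : ℝ), 0 < a → Y.Finite →
        (∀ p ∈ Y, ∀ q ∈ Y, p ≠ q → a * (1 - 1 / 50) ≤ dist p q ∧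
          (dist p q ≤ a * (1 + 1 / 50) ∨ a * (63 / 50) ≤ dist p q)) →
        (∀ z ∈ Y, {w ∈ Y | w ≠ z ∧ dist z w ≤ a * (1 + 1 / 50)}.ncard ≤ 12) →
        ∀ y ∈ Y,
          (∀ z ∈ Y, dist y z ≤ a * 3 → {w ∈ Y | w ≠ z ∧ dist z w ≤ a * (1 + 1 / 50)}.ncard = 12) →
          ∀ v ∈ Y, v ≠ y → dist y v ≤ a * (1 + 1 / 50) →
            {w ∈ Y | w ≠ y ∧ w ≠ v ∧ dist y w ≤ a * (1 + 1 / 50) ∧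
                dist v w ≤ a * (1 + 1 / 50)}.ncard ≤ 3 →
            ∀ e : EuclideanSpace ℝ (Fin 3), ‖e‖ = 1 → ⟪e, v - y⟫ = 0 →
              (∀ w ∈ Y, w ≠ y → w ≠ v → dist y w ≤ a * (1 + 1 / 50) →
                dist v w ≤ a * (1 + 1 / 50) → ⟪w - y, e⟫ ≤ 1 / 2 * ‖perpTo (v - y) (w - y)‖) →
              False) →
    TornFree := by
  intro h Y a ha hgood y hy v hv hvy hdv
  by_contra hlt
  push Not at hlt
  have h3 : {w ∈ Y | w ≠ y ∧ w ≠ v ∧ dist y w ≤ a * (1 + 1 / 50) ∧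
      dist v w ≤ a * (1 + 1 / 50)}.ncard ≤ 3 := by omega
  -- the empty sector about the bond, from the commons in `Y`
  obtain ⟨e, he1, heb, hsec⟩ := stub_tfEmptySector stub_tfCircleThree _ y v hvy
    (tf_commons_finite (hgood y hy).1) h3
  -- the finite patch
  obtain ⟨hfin, hgap, hle, htw⟩ := tf_patch_hyps ha hgood y
  have hyY' : y ∈ {z ∈ Y | dist y z ≤ a * 5} := ⟨hy, by rw [dist_self]; positivity⟩
  have hvY' : v ∈ {z ∈ Y | dist y z ≤ a * 5} := ⟨hv, hdv.trans (by nlinarith)⟩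
  have hsubC : {w ∈ {z ∈ Y | dist y z ≤ a * 5} | w ≠ y ∧ w ≠ v ∧ dist y w ≤ a * (1 + 1 / 50) ∧
      dist v w ≤ a * (1 + 1 / 50)} ⊆ {w ∈ Y | w ≠ y ∧ w ≠ v ∧ dist y w ≤ a * (1 + 1 / 50) ∧
      dist v w ≤ a * (1 + 1 / 50)} := fun w hw => ⟨hw.1.1, hw.2⟩
  have h3' : {w ∈ {z ∈ Y | dist y z ≤ a * 5} | w ≠ y ∧ w ≠ v ∧ dist y w ≤ a * (1 + 1 / 50) ∧
      dist v w ≤ a * (1 + 1 / 50)}.ncard ≤ 3 :=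
    (Set.ncard_le_ncard hsubC (tf_commons_finite (hgood y hy).1)).trans h3
  exact h stub_tfSectorWindows _ a ha hfin hgap hle y hyY' htw v hvY' hvy hdv
    h3' e he1 heb (fun w hw hwy hwv hdy hdvw => hsec w ⟨hw.1, hwy, hwv, hdy, hdvw⟩)

end Summit.AtomisticToContinuum.Crystallization.Theorems

end
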